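import Summits.HodgeConjecture.HodgeConjecture.Theorems.R90S4TwistedTubeTransversal          -- ★ p864410 (this seat) (B1-T) part 1: the sheeted transversal `B₀` and its (L1) letters
import Summits.HodgeConjecture.HodgeConjecture.Theorems.R90S4TwistedConjugationFamilyFibres   -- ★ p864149 (this seat) M1-TWIST: (LI), (FC), `twistedConjFamily_smul`, `continuous_twistedConjFamily`, the Ñ^θ and transversal lemmas
import Summits.HodgeConjecture.HodgeConjecture.Theorems.R90S4EpsWeylFinite                    -- ★ p864025 (p05) WEYL-ε: `index_centralizer_subgroupOf_epsNormalizer_ne_zero`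
import Summits.HodgeConjecture.HodgeConjecture.Theorems.R90S4EpsOrbitalCanonical               -- ★ `continuous_epsLoc`, `isClosed_epsCentralizer`
import Summits.HodgeConjecture.HodgeConjecture.Theorems.R90S4EpsRegularTransport               -- ★ `isEpsRegularAt_mul_mul_epsLoc_inv_iff`
import HarnessLib

/-!
# R90-TF · S4 «Ch. 13.1–2», T-WIF road, (B1-T) part 2a — THE ε-TWISTED TUBE OF A CARTAN AS A FINITE-FIBRE FAMILY: (LI), (FC), AND TWISTED-WEYL SEPARATION (injectivity over a
# norm window) (Rogawski 1990, §12.5 p. 186)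

Cell `hodgecm-mathlib`, crux H413 (`stmt-HodgeConjecture-24833`, lane `--supports … --as helper`), route of record `HCCMUnconditional` (no route verbs;
count-neutral).  Programme R90-TF, section S4 = [Rogawski1990] Ch. 13.1–13.2; seat R90-C131-p03 (g3); plan of record S4-R30∕S4-R33, census `R90/R90-C131-p03/g3/CENSUS-B1-assembly.md`.
THEOREMS ONLY — no `def`, no instance, no notation, no named-fact hypothesis, no `sorry`; ★-only imports.

HONEST LABEL: HC_CM is proved only modulo the 7 printed citations (2 remaining named inputs: hLiu418 = stmt-HodgeConjecture-24832, h413 =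
stmt-HodgeConjecture-24833) until rung 0 closes.  CONDITIONAL on the letters (L2) (Borel norm section `s`) and the `K_T`-representatives `R` — hypotheses; discharges no socket
(REL ≠ ★ ≠ BUILT).

## The mathematics

SETTING (form of record `Φ₃ = splitFormGL L`, `v` NON-SPLIT via `hns`): `T = Z_{G_v}(γ₀)` (`γ₀` regular), `T̃ = Cent_{G̃_v}(γ₀)` (closed, abelian, ε-stable ★ p863295), an ε-regular base point
`δ₀ ∈ T̃` and `T′ := G̃_{δ₀ε}` (`= {g ∈ T̃ : ε g = g}`, ★ `mem_epsCentralizer_iff_of_mem_centralizer`), the twisted family `Ψ(x T′, b) = x b ε(x)⁻¹` on `(G̃_v ⧸ T′) × T̃` (★ M1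
`exists_twistedConjFamily`), the ε-normaliser `Ñ^ε_T` (★ p864025's predicate `hN'`) with `w_T := [Ñ^ε_T : T̃] ≠ 0` (WEYL-ε ★), the norm section `s`, representatives `R` and the sheeted
transversal `B₀ = ⋃_{u ∈ R} s(T^{reg}) u` of part 1, `D := {(q, b) | b ∈ B₀}`.
* §1 (LI) + (FC) AT S4: the hypotheses of ★ M1-TWIST hold (`θ = ε` involutive ★ `twistLocal_twistLocal_cm`; `A = T̃`; `A^θ = T′`; regular set `{ε-regular}` with `Cent(N b) = T̃`
  ★ `centralizer_eq_centralizer_of_isRegularElt` and ε-conjugation invariance ★; transversal letters = part 1) — so `Ψ` is LOCALLY INJECTIVE on `D` and every fibre of `Ψ` over `Ψ(D)`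
  has exactly `w_T` points in `D`; `Ψ` is continuous and `Ψ(c • q, b) = c Ψ(q, b) ε(c)⁻¹`.
* §2 TWISTED-WEYL SEPARATION (this file's new point; it removes the injectivity clause from the Jacobian letter (J̃♭)): for a regular `t₁ ∈ T` there is an open NORM WINDOW
  `O ∋ ι(t₁)` in `G̃_v` such that `Ψ` is injective on `{(q, b) ∈ D | N b ∈ O}` — GLOBALLY in `q`.  Proof: `Ψ(xT′, b) = Ψ(x′T′, b′)` gives `y b′ ε(y)⁻¹ = b` for `y := x⁻¹x′`, hence
  `y ∈ Ñ^ε` (★ M1 `mem_normalizer_and_mul_map_inv_mem_of_twistedConj_eq`) and `N b = y N(b′) y⁻¹` (★ M1 `twistedConj_mul_map_twistedConj`).  If `y ∈ T̃` then `b = b′` and `y ∈ T′`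
  (★ M1 `eq_and_mem_of_twistedConj_eq_of_mem_transversal`), i.e. the two points of `D` coincide.  If `y ∉ T̃`, write `y = ȳ h` with `ȳ` the chosen representative of its class in the
  FINITE set `Ñ^ε ⧸ T̃` and `h ∈ T̃`; `T̃` abelian gives `N b = ȳ N(b′) ȳ⁻¹`; but `ȳ ι(t₁) ȳ⁻¹ ≠ ι(t₁)` (else `ȳ ∈ Cent(ι t₁) = T̃`, `t₁` regular), so Hausdorff separation yields a
  window `O_ȳ ∋ ι(t₁)` with `ȳ O_ȳ ȳ⁻¹ ∩ O_ȳ = ∅`, and `O := ⋂_ȳ O_ȳ` (finite intersection) excludes this case.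

[cite: Rogawski1990, §12.5 p. 186; §3.11 Prop. 3.11.2 pp. 34–35; §4.3 p. 43] [cite: HarishChandra1970, Lemma 42]
-/

set_option autoImplicit false
-- the mandated namespace repeats the single-problem summit's segment (`HodgeConjecture.HodgeConjecture`)
set_option linter.dupNamespace false

noncomputable section

open MeasureTheory Measure Set Filter Topology Function NumberField IsDedekindDomain
open scoped ENNReal NNReal MatrixGroups Pointwise

namespace Summit.HodgeConjecture.HodgeConjecture.R90.S4

open Literature.NumberTheory.Rogawski1990 Literature.NumberTheory.Rogawski1990.Ch4Sec10
open Literature.NumberTheory.Automorphic Literature.NumberTheory.Automorphic.UnitaryGroup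
open Literature.MeasureTheory.Group

section Fibres

variable {L : Type} [Field L] [NumberField L] [IsCMField L] {v : HeightOneSpectrum (𝓞 ↥(maximalRealSubfield L))}
  (hns : ∀ w : PlacesOver L v, IsCMField.complexConj L • w.1 = w.1)
  {T : Subgroup ((UnitaryGroup.cmDatum L 3 (splitFormGL L : Matrix (Fin 3) (Fin 3) L)).Local v)}
  {γ₀ : (UnitaryGroup.cmDatum L 3 (splitFormGL L : Matrix (Fin 3) (Fin 3) L)).Local v} (hγ₀ : IsRegularElt (γ₀.val : GtLoc L v))
  (hT : T = Subgroup.centralizer ({γ₀} : Set ((UnitaryGroup.cmDatum L 3 (splitFormGL L : Matrix (Fin 3) (Fin 3) L)).Local v)))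
  [LocallyCompactSpace (GtLoc L v)] [SecondCountableTopology (GtLoc L v)] [T2Space (GtLoc L v)] [MeasurableSpace (GtLoc L v)] [BorelSpace (GtLoc L v)]
  [∀ δ : GtLoc L v, MeasurableSpace (GtLoc L v ⧸ epsCentralizer (epsLoc L (splitFormGL L) v) δ)]
  [∀ δ : GtLoc L v, BorelSpace (GtLoc L v ⧸ epsCentralizer (epsLoc L (splitFormGL L) v) δ)]
  [MeasurableSpace ((UnitaryGroup.cmDatum L 3 (splitFormGL L : Matrix (Fin 3) (Fin 3) L)).Local v)] [BorelSpace ((UnitaryGroup.cmDatum L 3 (splitFormGL L : Matrix (Fin 3) (Fin 3) L)).Local v)]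
  {δ₀ : GtLoc L v} (hδ₀T : δ₀ ∈ Subgroup.centralizer ({(γ₀.val : GtLoc L v)} : Set (GtLoc L v))) (hδ₀reg : IsEpsRegularAt L (splitFormGL L) v δ₀)
  (Ψ : (GtLoc L v ⧸ epsCentralizer (epsLoc L (splitFormGL L) v) δ₀) × ↥(Subgroup.centralizer ({(γ₀.val : GtLoc L v)} : Set (GtLoc L v))) → GtLoc L v)
  (hΨ : ∀ (x : GtLoc L v) (b : ↥(Subgroup.centralizer ({(γ₀.val : GtLoc L v)} : Set (GtLoc L v)))), Ψ (QuotientGroup.mk x, b) = x * b * (epsLoc L (splitFormGL L) v x)⁻¹)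
  (N' : Subgroup (GtLoc L v))
  (hN' : ∀ m, m ∈ N' ↔ m ∈ Subgroup.normalizer ((Subgroup.centralizer ({(γ₀.val : GtLoc L v)} : Set (GtLoc L v)) : Subgroup (GtLoc L v)) : Set (GtLoc L v)) ∧
    m * (epsLoc L (splitFormGL L) v m)⁻¹ ∈ Subgroup.centralizer ({(γ₀.val : GtLoc L v)} : Set (GtLoc L v)))
  (s : ↥T → ↥(Subgroup.centralizer ({(γ₀.val : GtLoc L v)} : Set (GtLoc L v)))) (hsm : Measurable s)
  (hsN : ∀ t : ↥T, epsNorm (epsLoc L (splitFormGL L) v) (s t : GtLoc L v) = ((t : (UnitaryGroup.cmDatum L 3 (splitFormGL L : Matrix (Fin 3) (Fin 3) L)).Local v)).val)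
  (R : Finset ↥(Subgroup.centralizer ({(γ₀.val : GtLoc L v)} : Set (GtLoc L v))))
  (hRN : ∀ u ∈ R, epsNorm (epsLoc L (splitFormGL L) v) (u : GtLoc L v) = 1)
  (hRcov : ∀ w : ↥(Subgroup.centralizer ({(γ₀.val : GtLoc L v)} : Set (GtLoc L v))), epsNorm (epsLoc L (splitFormGL L) v) (w : GtLoc L v) = 1 →
    ∃ u ∈ R, ∃ a : ↥(Subgroup.centralizer ({(γ₀.val : GtLoc L v)} : Set (GtLoc L v))), (w : GtLoc L v) = u * (a * (epsLoc L (splitFormGL L) v a)⁻¹))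
  (hRinj : ∀ u ∈ R, ∀ u' ∈ R, (∃ a : ↥(Subgroup.centralizer ({(γ₀.val : GtLoc L v)} : Set (GtLoc L v))),
    ((u' : ↥(Subgroup.centralizer ({(γ₀.val : GtLoc L v)} : Set (GtLoc L v)))) : GtLoc L v) = u * (a * (epsLoc L (splitFormGL L) v a)⁻¹)) → u = u')

/-! ## §1 The hypotheses of ★ M1-TWIST at S4: (LI) and (FC) for the ε-twisted tube of `T` over `B₀` -/

omit [LocallyCompactSpace (GtLoc L v)] [SecondCountableTopology (GtLoc L v)] [T2Space (GtLoc L v)] [MeasurableSpace (GtLoc L v)] [BorelSpace (GtLoc L v)]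
  [∀ δ : GtLoc L v, MeasurableSpace (GtLoc L v ⧸ epsCentralizer (epsLoc L (splitFormGL L) v) δ)]
  [∀ δ : GtLoc L v, BorelSpace (GtLoc L v ⧸ epsCentralizer (epsLoc L (splitFormGL L) v) δ)]
  [MeasurableSpace ((UnitaryGroup.cmDatum L 3 (splitFormGL L : Matrix (Fin 3) (Fin 3) L)).Local v)] [BorelSpace ((UnitaryGroup.cmDatum L 3 (splitFormGL L : Matrix (Fin 3) (Fin 3) L)).Local v)] in
include hγ₀ hδ₀T hδ₀reg in
/-- `T′ = G̃_{δ₀ε}` has the membership predicate `g ∈ T̃ ∧ ε g = g` (★ `mem_epsCentralizer_iff_of_mem_centralizer`, conjuncts swapped into ★ M1's `hAθ` shape).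
[cite: Rogawski1990, §3.11 Prop. 3.11.2 pp. 34–35; §12.5 p. 186] -/
theorem mem_epsCentralizer_base_iff (g : GtLoc L v) :
    g ∈ epsCentralizer (epsLoc L (splitFormGL L) v) δ₀ ↔ g ∈ Subgroup.centralizer ({(γ₀.val : GtLoc L v)} : Set (GtLoc L v)) ∧ epsLoc L (splitFormGL L) v g = g := by
  rw [mem_epsCentralizer_iff_of_mem_centralizer (splitFormGL_isHermitian L) hγ₀ hδ₀T hδ₀reg g, and_comm]

omit [LocallyCompactSpace (GtLoc L v)] [SecondCountableTopology (GtLoc L v)] [T2Space (GtLoc L v)] [MeasurableSpace (GtLoc L v)] [BorelSpace (GtLoc L v)]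
  [∀ δ : GtLoc L v, MeasurableSpace (GtLoc L v ⧸ epsCentralizer (epsLoc L (splitFormGL L) v) δ)]
  [∀ δ : GtLoc L v, BorelSpace (GtLoc L v ⧸ epsCentralizer (epsLoc L (splitFormGL L) v) δ)]
  [MeasurableSpace ((UnitaryGroup.cmDatum L 3 (splitFormGL L : Matrix (Fin 3) (Fin 3) L)).Local v)] [BorelSpace ((UnitaryGroup.cmDatum L 3 (splitFormGL L : Matrix (Fin 3) (Fin 3) L)).Local v)] in
include hγ₀ in
/-- **Regularity letter `hRA` of ★ M1 at S4**: for ε-regular `b ∈ T̃`, `Cent(b · ε b) = Cent(N b) = T̃` (the norm of `b` is a regular element of the abelian `T̃`).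
[cite: Rogawski1990, §12.5 p. 186; §3.1 p. 19] -/
theorem centralizer_mul_epsLoc_eq_of_isEpsRegularAt (b : ↥(Subgroup.centralizer ({(γ₀.val : GtLoc L v)} : Set (GtLoc L v))))
    (hb : (b : GtLoc L v) ∈ {δ : GtLoc L v | IsEpsRegularAt L (splitFormGL L) v δ}) :
    Subgroup.centralizer ({(b : GtLoc L v) * epsLoc L (splitFormGL L) v (b : GtLoc L v)} : Set (GtLoc L v)) = Subgroup.centralizer ({(γ₀.val : GtLoc L v)} : Set (GtLoc L v)) :=
  centralizer_eq_centralizer_of_isRegularElt hγ₀ ((isEpsRegularAt_iff L (splitFormGL L) v _).1 hb) (epsNorm_mem_centralizer_coe γ₀ b.2)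

omit [LocallyCompactSpace (GtLoc L v)] [SecondCountableTopology (GtLoc L v)] [MeasurableSpace (GtLoc L v)] [BorelSpace (GtLoc L v)]
  [∀ δ : GtLoc L v, MeasurableSpace (GtLoc L v ⧸ epsCentralizer (epsLoc L (splitFormGL L) v) δ)]
  [∀ δ : GtLoc L v, BorelSpace (GtLoc L v ⧸ epsCentralizer (epsLoc L (splitFormGL L) v) δ)]
  [MeasurableSpace ((UnitaryGroup.cmDatum L 3 (splitFormGL L : Matrix (Fin 3) (Fin 3) L)).Local v)] [BorelSpace ((UnitaryGroup.cmDatum L 3 (splitFormGL L : Matrix (Fin 3) (Fin 3) L)).Local v)] in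
include hns hγ₀ hδ₀T hδ₀reg hΨ hN' hsN hRN hRinj in
/-- **(LI) AT S4 — the ε-twisted tube map of `T` is locally injective on `D = {(q, b) | b ∈ B₀}`** (★ M1-TWIST `exists_isOpen_injOn_twistedConjFamily` fed with the S4 letters: `ε` involutive,
`T̃` closed abelian ε-stable, `T′ = G̃_{δ₀ε}`, `[Ñ^ε_T : T̃] ≠ 0` ★ p864025, regularity, and part 1's transversal letters). [cite: Rogawski1990, §12.5 p. 186] [cite: HarishChandra1970, Lemma 42] -/
theorem exists_isOpen_injOn_epsTube (p : (GtLoc L v ⧸ epsCentralizer (epsLoc L (splitFormGL L) v) δ₀) × ↥(Subgroup.centralizer ({(γ₀.val : GtLoc L v)} : Set (GtLoc L v)))) :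
    ∃ U : Set ((GtLoc L v ⧸ epsCentralizer (epsLoc L (splitFormGL L) v) δ₀) × ↥(Subgroup.centralizer ({(γ₀.val : GtLoc L v)} : Set (GtLoc L v)))), IsOpen U ∧ p ∈ U ∧
      InjOn Ψ (U ∩ {p | p.2 ∈ {b : ↥(Subgroup.centralizer ({(γ₀.val : GtLoc L v)} : Set (GtLoc L v))) |
        ∃ t : ↥T, IsRegularElt (((t : (UnitaryGroup.cmDatum L 3 (splitFormGL L : Matrix (Fin 3) (Fin 3) L)).Local v)).val : GtLoc L v) ∧ ∃ u ∈ R, b = s t * u}}) := by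
  have hΦ := splitFormGL_isHermitian L
  exact exists_isOpen_injOn_twistedConjFamily (epsLoc L (splitFormGL L) v) (twistLocal_twistLocal_cm L 3 (splitFormGL L) hΦ v)
    (Subgroup.centralizer ({(γ₀.val : GtLoc L v)} : Set (GtLoc L v))) (Set.isClosed_centralizer _)
    (fun a ha b hb => mul_comm_of_mem_centralizer_of_isRegularElt hγ₀ ha hb) (fun a ha => epsLoc_mem_centralizer_coe γ₀ ha)
    (epsCentralizer (epsLoc L (splitFormGL L) v) δ₀) (mem_epsCentralizer_base_iff hγ₀ hδ₀T hδ₀reg) N' hN'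
    (index_centralizer_subgroupOf_epsNormalizer_ne_zero L (splitFormGL L) v hns γ₀ hγ₀ N' hN') Ψ hΨ
    {δ : GtLoc L v | IsEpsRegularAt L (splitFormGL L) v δ} (centralizer_mul_epsLoc_eq_of_isEpsRegularAt hγ₀)
    _ (fun b hb => isEpsRegularAt_of_mem_sheetTransversal hγ₀ s hsN R hRN hb)
    (fun b hb b' hb' h => eq_of_mem_sheetTransversal_of_mul_eq hγ₀ s hsN R hRN hRinj hb hb' h) p

omit [LocallyCompactSpace (GtLoc L v)] [SecondCountableTopology (GtLoc L v)] [T2Space (GtLoc L v)] [MeasurableSpace (GtLoc L v)] [BorelSpace (GtLoc L v)]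
  [∀ δ : GtLoc L v, MeasurableSpace (GtLoc L v ⧸ epsCentralizer (epsLoc L (splitFormGL L) v) δ)]
  [∀ δ : GtLoc L v, BorelSpace (GtLoc L v ⧸ epsCentralizer (epsLoc L (splitFormGL L) v) δ)]
  [MeasurableSpace ((UnitaryGroup.cmDatum L 3 (splitFormGL L : Matrix (Fin 3) (Fin 3) L)).Local v)] [BorelSpace ((UnitaryGroup.cmDatum L 3 (splitFormGL L : Matrix (Fin 3) (Fin 3) L)).Local v)] in
include hns hγ₀ hT hδ₀T hδ₀reg hΨ hN' hsN hRN hRcov hRinj in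
/-- **(FC) AT S4 — every fibre of the ε-twisted tube map over `Ψ(D)` has exactly `[Ñ^ε_T : T̃]` points in `D`** (★ M1-TWIST `count_fibre_twistedConjFamily_eq`, same letters plus the covering
letter of part 1 and ε-conjugation invariance of ε-regularity ★). [cite: Rogawski1990, §12.5 p. 186] [cite: HarishChandra1970, Lemma 42] -/
theorem count_fibre_epsTube_eq
    [MeasurableSpace ((GtLoc L v ⧸ epsCentralizer (epsLoc L (splitFormGL L) v) δ₀) × ↥(Subgroup.centralizer ({(γ₀.val : GtLoc L v)} : Set (GtLoc L v))))]
    [MeasurableSingletonClass ((GtLoc L v ⧸ epsCentralizer (epsLoc L (splitFormGL L) v) δ₀) × ↥(Subgroup.centralizer ({(γ₀.val : GtLoc L v)} : Set (GtLoc L v))))]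
    {y : GtLoc L v}
    (hy : y ∈ Ψ '' {p | p.2 ∈ {b : ↥(Subgroup.centralizer ({(γ₀.val : GtLoc L v)} : Set (GtLoc L v))) |
        ∃ t : ↥T, IsRegularElt (((t : (UnitaryGroup.cmDatum L 3 (splitFormGL L : Matrix (Fin 3) (Fin 3) L)).Local v)).val : GtLoc L v) ∧ ∃ u ∈ R, b = s t * u}}) :
    Measure.count (Ψ ⁻¹' {y} ∩ {p | p.2 ∈ {b : ↥(Subgroup.centralizer ({(γ₀.val : GtLoc L v)} : Set (GtLoc L v))) |
        ∃ t : ↥T, IsRegularElt (((t : (UnitaryGroup.cmDatum L 3 (splitFormGL L : Matrix (Fin 3) (Fin 3) L)).Local v)).val : GtLoc L v) ∧ ∃ u ∈ R, b = s t * u}}) =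
      ((((Subgroup.centralizer ({(γ₀.val : GtLoc L v)} : Set (GtLoc L v))).subgroupOf N').index : ℕ) : ℝ≥0∞) := by
  have hΦ := splitFormGL_isHermitian L
  exact count_fibre_twistedConjFamily_eq (epsLoc L (splitFormGL L) v) (twistLocal_twistLocal_cm L 3 (splitFormGL L) hΦ v)
    (Subgroup.centralizer ({(γ₀.val : GtLoc L v)} : Set (GtLoc L v)))
    (fun a ha b hb => mul_comm_of_mem_centralizer_of_isRegularElt hγ₀ ha hb) (fun a ha => epsLoc_mem_centralizer_coe γ₀ ha)
    (epsCentralizer (epsLoc L (splitFormGL L) v) δ₀) (mem_epsCentralizer_base_iff hγ₀ hδ₀T hδ₀reg) N' hN'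
    (index_centralizer_subgroupOf_epsNormalizer_ne_zero L (splitFormGL L) v hns γ₀ hγ₀ N' hN') Ψ hΨ
    {δ : GtLoc L v | IsEpsRegularAt L (splitFormGL L) v δ} (centralizer_mul_epsLoc_eq_of_isEpsRegularAt hγ₀)
    (fun g x hx => (isEpsRegularAt_mul_mul_epsLoc_inv_iff hΦ g x).2 hx)
    _ (fun b hb => isEpsRegularAt_of_mem_sheetTransversal hγ₀ s hsN R hRN hb)
    (fun b hb b' hb' h => eq_of_mem_sheetTransversal_of_mul_eq hγ₀ s hsN R hRN hRinj hb hb' h)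
    (fun b hb => exists_mem_sheetTransversal_of_isEpsRegularAt hγ₀ hT s hsN R hRcov b hb) hy

omit [LocallyCompactSpace (GtLoc L v)] [SecondCountableTopology (GtLoc L v)] [T2Space (GtLoc L v)] [MeasurableSpace (GtLoc L v)] [BorelSpace (GtLoc L v)]
  [∀ δ : GtLoc L v, MeasurableSpace (GtLoc L v ⧸ epsCentralizer (epsLoc L (splitFormGL L) v) δ)]
  [∀ δ : GtLoc L v, BorelSpace (GtLoc L v ⧸ epsCentralizer (epsLoc L (splitFormGL L) v) δ)]
  [MeasurableSpace ((UnitaryGroup.cmDatum L 3 (splitFormGL L : Matrix (Fin 3) (Fin 3) L)).Local v)] [BorelSpace ((UnitaryGroup.cmDatum L 3 (splitFormGL L : Matrix (Fin 3) (Fin 3) L)).Local v)] in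
include hΨ in
/-- **Equivariance and continuity of the ε-twisted tube map at S4**: `Ψ(c • q, b) = c Ψ(q, b) ε(c)⁻¹` (★ M2's shape with `e(c) = ε(c)⁻¹`) and `Ψ` is continuous (★ `continuous_epsLoc`).
[cite: Rogawski1990, §12.5 p. 186] -/
theorem epsTube_smul_and_continuous :
    (∀ (c : GtLoc L v) (q : GtLoc L v ⧸ epsCentralizer (epsLoc L (splitFormGL L) v) δ₀) (b : ↥(Subgroup.centralizer ({(γ₀.val : GtLoc L v)} : Set (GtLoc L v)))),
        Ψ (c • q, b) = c * Ψ (q, b) * (fun c : GtLoc L v => (epsLoc L (splitFormGL L) v c)⁻¹) c) ∧ Continuous Ψ :=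
  ⟨fun c q b => twistedConjFamily_smul (epsLoc L (splitFormGL L) v) _ Subtype.val Ψ hΨ c q b,
    continuous_twistedConjFamily (epsLoc L (splitFormGL L) v) _ Subtype.val Ψ hΨ (continuous_epsLoc L (splitFormGL L) v) continuous_subtype_val⟩

/-! ## §2 Twisted-Weyl separation: the ε-twisted tube map is injective over a norm window, globally in the `G̃_v ⧸ T′`-variable -/

omit [LocallyCompactSpace (GtLoc L v)] [SecondCountableTopology (GtLoc L v)] [MeasurableSpace (GtLoc L v)] [BorelSpace (GtLoc L v)]
  [∀ δ : GtLoc L v, MeasurableSpace (GtLoc L v ⧸ epsCentralizer (epsLoc L (splitFormGL L) v) δ)]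
  [∀ δ : GtLoc L v, BorelSpace (GtLoc L v ⧸ epsCentralizer (epsLoc L (splitFormGL L) v) δ)]
  [MeasurableSpace ((UnitaryGroup.cmDatum L 3 (splitFormGL L : Matrix (Fin 3) (Fin 3) L)).Local v)] [BorelSpace ((UnitaryGroup.cmDatum L 3 (splitFormGL L : Matrix (Fin 3) (Fin 3) L)).Local v)] in
set_option maxHeartbeats 400000 in
-- twice the default: instance-term unification on the CM local carrier (`↥N' ⧸ T̃.subgroupOf N'`, `G̃_v ⧸ T′`), as in ★ (E1b) `F0P3cStCharTSWeylCartanJacobian`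
include hns hγ₀ hT hδ₀T hδ₀reg hΨ hN' hsN hRN hRinj in
/-- **TWISTED-WEYL SEPARATION — injectivity of the ε-twisted tube map of `T` over a norm window.**  For a regular `t₁ ∈ T` there is an open `O ∋ ι(t₁)` in `G̃_v` such that
`Ψ` is injective on `{(q, b) | b ∈ B₀, N b ∈ O}` (all `q ∈ G̃_v ⧸ T′`): a coincidence `Ψ(xT′, b) = Ψ(x′T′, b′)` forces `y := x⁻¹x′ ∈ Ñ^ε` with `N b = y N(b′) y⁻¹`; `y ∈ T̃` gives the same
point of `D` (transversal `B₀`, `T′ = T̃^ε`), and the finitely many classes `ȳ ∈ Ñ^ε ⧸ T̃` with `ȳ ∉ T̃` move `ι(t₁)` (`Cent(ι t₁) = T̃`), so a Hausdorff window around `ι(t₁)` excludes them.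
This is the «`W̃`-small neighbourhood» of the twisted Weyl integration formula, in the only form a BOREL transversal allows (windows in the NORM, not in `b`).
[cite: Rogawski1990, §12.5 p. 186; §3.11 Prop. 3.11.2 pp. 34–35] [cite: HarishChandra1970, Lemma 42] -/
theorem exists_normWindow_injOn_epsTube (t₁ : ↥T)
    (ht₁ : IsRegularElt (((t₁ : (UnitaryGroup.cmDatum L 3 (splitFormGL L : Matrix (Fin 3) (Fin 3) L)).Local v)).val : GtLoc L v)) :
    ∃ O : Set (GtLoc L v), IsOpen O ∧ (((t₁ : (UnitaryGroup.cmDatum L 3 (splitFormGL L : Matrix (Fin 3) (Fin 3) L)).Local v)).val : GtLoc L v) ∈ O ∧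
      InjOn Ψ ((univ ×ˢ {b : ↥(Subgroup.centralizer ({(γ₀.val : GtLoc L v)} : Set (GtLoc L v))) | epsNorm (epsLoc L (splitFormGL L) v) (b : GtLoc L v) ∈ O}) ∩
        {p | p.2 ∈ {b : ↥(Subgroup.centralizer ({(γ₀.val : GtLoc L v)} : Set (GtLoc L v))) |
          ∃ t : ↥T, IsRegularElt (((t : (UnitaryGroup.cmDatum L 3 (splitFormGL L : Matrix (Fin 3) (Fin 3) L)).Local v)).val : GtLoc L v) ∧ ∃ u ∈ R, b = s t * u}}) := by
  classical
  have hΦ := splitFormGL_isHermitian L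
  have hθ := twistLocal_twistLocal_cm L 3 (splitFormGL L) hΦ v
  let Tt : Subgroup (GtLoc L v) := Subgroup.centralizer ({(γ₀.val : GtLoc L v)} : Set (GtLoc L v))
  let B₀ : Set ↥Tt := {b : ↥Tt | ∃ t : ↥T, IsRegularElt (((t : (UnitaryGroup.cmDatum L 3 (splitFormGL L : Matrix (Fin 3) (Fin 3) L)).Local v)).val : GtLoc L v) ∧
    ∃ u ∈ R, b = s t * u}
  let z₁ : GtLoc L v := (((t₁ : (UnitaryGroup.cmDatum L 3 (splitFormGL L : Matrix (Fin 3) (Fin 3) L)).Local v)).val : GtLoc L v)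
  have hcent : Subgroup.centralizer ({z₁} : Set (GtLoc L v)) = Tt := centralizer_coe_eq_of_isRegularElt hγ₀ hT t₁ ht₁
  have hcomm : ∀ a ∈ Tt, ∀ b ∈ Tt, a * b = b * a := fun a ha b hb => mul_comm_of_mem_centralizer_of_isRegularElt hγ₀ ha hb
  -- the finite twisted Weyl set `Ñ^ε ⧸ T̃`
  let H : Subgroup ↥N' := Tt.subgroupOf N'
  haveI : H.FiniteIndex := ⟨index_centralizer_subgroupOf_epsNormalizer_ne_zero L (splitFormGL L) v hns γ₀ hγ₀ N' hN'⟩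
  -- chosen representatives of the classes, read in `G̃_v`
  let rep : ↥N' ⧸ H → GtLoc L v := fun w => ((w.out : ↥N') : GtLoc L v)
  -- one Hausdorff window per class moving `ι(t₁)`
  have hwin : ∀ w : ↥N' ⧸ H, ∃ Ow : Set (GtLoc L v), IsOpen Ow ∧ z₁ ∈ Ow ∧
      (rep w ∉ Tt → ∀ z ∈ Ow, ∀ z' ∈ Ow, rep w * z * (rep w)⁻¹ ≠ z') := by
    intro w
    by_cases hy : rep w ∈ Tt
    · exact ⟨univ, isOpen_univ, mem_univ _, fun h => absurd hy h⟩
    · have hne : rep w * z₁ * (rep w)⁻¹ ≠ z₁ := by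
        intro h
        apply hy
        rw [← hcent, Subgroup.mem_centralizer_singleton_iff]
        exact mul_inv_eq_iff_eq_mul.1 h
      obtain ⟨O₁, O₂, hO₁, hO₂, h₁, h₂, hdisj⟩ := t2_separation hne
      refine ⟨O₂ ∩ (fun z => rep w * z * (rep w)⁻¹) ⁻¹' O₁,
        hO₂.inter (hO₁.preimage ((continuous_const.mul continuous_id).mul continuous_const)), ⟨h₂, h₁⟩, fun _ z hz z' hz' h => ?_⟩
      have hz'1 : z' ∈ O₁ := by rw [← h]; exact hz.2
      exact Set.disjoint_left.1 hdisj hz'1 hz'.1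
  choose Ow hOo hOz hOsep using hwin
  refine ⟨⋂ w, Ow w, isOpen_iInter_of_finite hOo, mem_iInter.2 hOz, ?_⟩
  -- injectivity on `{(q, b) ∈ D | N b ∈ O}`
  rintro ⟨q, b⟩ ⟨⟨-, hbO⟩, hbB⟩ ⟨q', b'⟩ ⟨⟨-, hb'O⟩, hb'B⟩ heq
  have hbO' : ∀ w, epsNorm (epsLoc L (splitFormGL L) v) (b : GtLoc L v) ∈ Ow w := fun w => mem_iInter.1 hbO w
  have hb'O' : ∀ w, epsNorm (epsLoc L (splitFormGL L) v) (b' : GtLoc L v) ∈ Ow w := fun w => mem_iInter.1 hb'O w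
  change b ∈ B₀ at hbB
  change b' ∈ B₀ at hb'B
  obtain ⟨x, rfl⟩ := QuotientGroup.mk_surjective q
  obtain ⟨x', rfl⟩ := QuotientGroup.mk_surjective q'
  rw [hΨ, hΨ] at heq
  -- `y := x⁻¹ x′` twists `b′` to `b`
  set y : GtLoc L v := x⁻¹ * x' with hy
  have hrel : y * (b' : GtLoc L v) * (epsLoc L (splitFormGL L) v y)⁻¹ = b := by
    have h3 : x⁻¹ * (x' * (b' : GtLoc L v) * (epsLoc L (splitFormGL L) v x')⁻¹) * epsLoc L (splitFormGL L) v x = b := by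
      rw [← heq]; simp only [mul_assoc, inv_mul_cancel, mul_one, inv_mul_cancel_left]
    rw [hy, map_mul, map_inv, mul_inv_rev, inv_inv, ← h3]; simp only [mul_assoc]
  -- `y ∈ Ñ^ε`
  have hcb : Subgroup.centralizer ({(b : GtLoc L v) * epsLoc L (splitFormGL L) v (b : GtLoc L v)} : Set (GtLoc L v)) = Tt :=
    centralizer_mul_epsLoc_eq_of_isEpsRegularAt hγ₀ b (isEpsRegularAt_of_mem_sheetTransversal hγ₀ s hsN R hRN hbB)
  have hcb' : Subgroup.centralizer ({(b' : GtLoc L v) * epsLoc L (splitFormGL L) v (b' : GtLoc L v)} : Set (GtLoc L v)) = Tt :=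
    centralizer_mul_epsLoc_eq_of_isEpsRegularAt hγ₀ b' (isEpsRegularAt_of_mem_sheetTransversal hγ₀ s hsN R hRN hb'B)
  obtain ⟨hyN, hyT⟩ := mem_normalizer_and_mul_map_inv_mem_of_twistedConj_eq (epsLoc L (splitFormGL L) v) hθ Tt b'.2 b.2 hcb' hcb hrel
  have hyN' : y ∈ N' := (hN' y).2 ⟨hyN, hyT⟩
  by_cases hyTt : y ∈ Tt
  · -- same class: the transversal forces `b = b′`, and `y ∈ T′`
    obtain ⟨hbb, hyT'⟩ := eq_and_mem_of_twistedConj_eq_of_mem_transversal (epsLoc L (splitFormGL L) v) Tt hcomm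
      (epsCentralizer (epsLoc L (splitFormGL L) v) δ₀) (mem_epsCentralizer_base_iff hγ₀ hδ₀T hδ₀reg) B₀
      (fun c hc c' hc' h => eq_of_mem_sheetTransversal_of_mul_eq hγ₀ s hsN R hRN hRinj hc hc' h) hyTt hb'B hbB hrel
    have hq : (QuotientGroup.mk x : GtLoc L v ⧸ epsCentralizer (epsLoc L (splitFormGL L) v) δ₀) = QuotientGroup.mk x' :=
      QuotientGroup.eq.2 hyT'
    exact Prod.ext hq hbb.symm
  · -- different classes are excluded by the window
    exfalso
    obtain ⟨h, hh⟩ := QuotientGroup.mk_out_eq_mul H ⟨y, hyN'⟩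
    have hhT : ((h : ↥N') : GtLoc L v) ∈ Tt := Subgroup.mem_subgroupOf.1 h.2
    have hout : rep (QuotientGroup.mk (⟨y, hyN'⟩ : ↥N')) = y * ((h : ↥N') : GtLoc L v) := by
      show (((QuotientGroup.mk (⟨y, hyN'⟩ : ↥N') : ↥N' ⧸ H).out : ↥N') : GtLoc L v) = _
      rw [hh, Subgroup.coe_mul]
    have hwout : rep (QuotientGroup.mk (⟨y, hyN'⟩ : ↥N')) ∉ Tt := by
      intro hmem
      apply hyTt
      have hy' : y = rep (QuotientGroup.mk (⟨y, hyN'⟩ : ↥N')) * (((h : ↥N') : GtLoc L v))⁻¹ := by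
        rw [hout, mul_inv_cancel_right]
      rw [hy']
      exact Tt.mul_mem hmem (Tt.inv_mem hhT)
    have hNb' : epsNorm (epsLoc L (splitFormGL L) v) (b' : GtLoc L v) ∈ Tt :=
      epsNorm_mem_centralizer_coe (Φ := splitFormGL L) γ₀ b'.2
    -- `N b = y N(b′) y⁻¹ = ȳ N(b′) ȳ⁻¹`
    have h1 : epsNorm (epsLoc L (splitFormGL L) v) (b : GtLoc L v) = y * epsNorm (epsLoc L (splitFormGL L) v) (b' : GtLoc L v) * y⁻¹ := by
      have h2 := twistedConj_mul_map_twistedConj (epsLoc L (splitFormGL L) v) hθ y (b' : GtLoc L v)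
      rw [hrel] at h2
      show (b : GtLoc L v) * epsLoc L (splitFormGL L) v (b : GtLoc L v) = y * ((b' : GtLoc L v) * epsLoc L (splitFormGL L) v (b' : GtLoc L v)) * y⁻¹
      exact h2
    have hconj : rep (QuotientGroup.mk (⟨y, hyN'⟩ : ↥N')) * epsNorm (epsLoc L (splitFormGL L) v) (b' : GtLoc L v) *
        (rep (QuotientGroup.mk (⟨y, hyN'⟩ : ↥N')))⁻¹ = epsNorm (epsLoc L (splitFormGL L) v) (b : GtLoc L v) := by
      rw [h1, hout, mul_inv_rev]
      have hc : ((h : ↥N') : GtLoc L v) * epsNorm (epsLoc L (splitFormGL L) v) (b' : GtLoc L v) =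
          epsNorm (epsLoc L (splitFormGL L) v) (b' : GtLoc L v) * ((h : ↥N') : GtLoc L v) := hcomm _ hhT _ hNb'
      calc y * ((h : ↥N') : GtLoc L v) * epsNorm (epsLoc L (splitFormGL L) v) (b' : GtLoc L v) * ((((h : ↥N') : GtLoc L v))⁻¹ * y⁻¹)
          = y * (((h : ↥N') : GtLoc L v) * epsNorm (epsLoc L (splitFormGL L) v) (b' : GtLoc L v)) * ((((h : ↥N') : GtLoc L v))⁻¹ * y⁻¹) := by
            simp only [mul_assoc]
        _ = y * (epsNorm (epsLoc L (splitFormGL L) v) (b' : GtLoc L v) * ((h : ↥N') : GtLoc L v)) * ((((h : ↥N') : GtLoc L v))⁻¹ * y⁻¹) := by rw [hc]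
        _ = y * epsNorm (epsLoc L (splitFormGL L) v) (b' : GtLoc L v) * y⁻¹ := by simp only [mul_assoc, mul_inv_cancel_left]
    exact hOsep _ hwout _ (hb'O' _) _ (hbO' _) hconj

end Fibres

end Summit.HodgeConjecture.HodgeConjecture.R90.S4

end
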